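import Literature.Analysis.Complex.Montel
import HarnessLib

/-!
# Montel's theorem for a uniformly bounded sequence on a disc

Stub `stub_montelBoundedDisc` (W3a) of the line `Sketch` (infimum descent) for the crux
`SpectralDefectExtinction.ChiralDescent` (item stmt-QuantumFields-17527).

A sequence of functions holomorphic on the open disc `B(z₀, r)` and bounded there by one constant
`M` has a subsequence converging locally uniformly on the disc, and the limit is holomorphic on the
disc (P. Montel 1907; J. B. Conway, *Functions of one complex variable I*, Ch. VII Thm. 2.9 with
Thm. 2.1; R. Remmert, *Classical Topics in Complex Function Theory*, §7.1–7.2).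

The tree already proves Montel's theorem on an arbitrary open set `U ⊆ ℂ`, in the uniformly
bounded form with the holomorphy of the limit recorded:
`Literature/Analysis/Complex/Montel.lean`,
`Complex.exists_strictMono_tendstoLocallyUniformlyOn_of_norm_le` (Cauchy's estimate for the
derivative, the mean value inequality, and Mathlib's abstract Arzelà–Ascoli theorem in `C(U, ℂ)`,
then `TendstoLocallyUniformlyOn.differentiableOn`). This file specialises it to
`U = Metric.ball z₀ r` — open for every real `r`, so the degenerate case `r ≤ 0` (empty ball) needs
no separate treatment — and reorders the conclusion into the registered shape.

Deliberately NOT here: the Vitali–Porter consequence (convergence on a set with an accumulation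
point forces locally uniform convergence of the whole sequence), which is the neighbouring stub
`stub_vitaliOfMontel` of the same line.
-/

namespace Summit.QuantumFields.QCD.Cruxes.ChiralDescent.InfimumDescent

open Filter Topology

/-- **Stub W3a — Montel's theorem for a uniformly bounded sequence on a disc** (H1 engine,
transport step, first half; classical: Montel 1907, Conway VII.2.9). A sequence `F k` of functions
holomorphic on the disc `Metric.ball z₀ r` with `‖F k z‖ ≤ M` on the disc has a subsequence
`F ∘ φ`, `φ` strictly monotone, converging locally uniformly on the disc to a function `G`
holomorphic on the disc. Immediate from the tree's Montel theorem
`Complex.exists_strictMono_tendstoLocallyUniformlyOn_of_norm_le` applied to the open set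
`Metric.ball z₀ r`. [folklore] -/
theorem stub_montelBoundedDisc :
    ∀ (F : ℕ → ℂ → ℂ) (z₀ : ℂ) (r M : ℝ),
      (∀ k, DifferentiableOn ℂ (F k) (Metric.ball z₀ r)) →
      (∀ k, ∀ z ∈ Metric.ball z₀ r, ‖F k z‖ ≤ M) →
      ∃ φ : ℕ → ℕ, StrictMono φ ∧ ∃ G : ℂ → ℂ, DifferentiableOn ℂ G (Metric.ball z₀ r) ∧
        TendstoLocallyUniformlyOn (fun k => F (φ k)) G atTop (Metric.ball z₀ r) := by
  intro F z₀ r M hF hM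
  obtain ⟨G, φ, hφ, hG, hlim, -⟩ :=
    Complex.exists_strictMono_tendstoLocallyUniformlyOn_of_norm_le Metric.isOpen_ball hF hM
  exact ⟨φ, hφ, G, hG, hlim⟩

end Summit.QuantumFields.QCD.Cruxes.ChiralDescent.InfimumDescent
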